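import Mathlib
import Summits.Parity.BatemanHorn.Theorems.IsogenyRedeiTypeIMainTermEulerControl
import Summits.Parity.BatemanHorn.Theorems.IsogenyRedeiTypeIMainTermRates
import Summits.Parity.BatemanHorn.Theorems.IsogenyRedeiTypeIMainTermHyperbola
import Summits.Parity.BatemanHorn.Theorems.IsogenyRedeiTypeIMainTermConvolutionLimit
import HarnessLib

/-!
# Type-I main term for Bateman–Horn (stmt-Parity-0873), input B3 (part 5):
# `∑_n ‖𝓮(n)‖ < ∞` for a Bateman–Horn system

* `summable_norm1_eFun` — for `f : Fin k → ℤ[X]` with every `f_i` irreducible, the `f_i`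
  pairwise non-associated and `ρ_{f_i}(p) < p` for all `i, p`: `∑_n ‖𝓮(n)‖_{ℓ¹} < ∞`.

Proof: `sum_le_prod_tsum_of_submultiplicative` with `h(n) = ‖𝓮(n)‖`; the local series are
`1 + w_p`, and for the good primes `p ≥ P₁` (no two `f_i` with a common root mod `p`, `p ≥ 2B`)
`w_p ≤ (k+1) M_k B² (1 + log p)^{k+1}/p²` (`tsum_norm1_eFun_prime_pow_le_of_good`), a summable
majorant (`summable_primes_one_add_log_pow_div_sq`). Everything here is proved.
-/

noncomputable section

open Finset Polynomial ArithmeticFunction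
open scoped ArithmeticFunction.Moebius

namespace Summit.Parity.BatemanHorn.Theorems.TypeIMainTerm

open Literature.NumberTheory.Sieve Literature.NumberTheory.LFunctions

variable {k : ℕ} (f : Fin k → ℤ[X])

/-- **`∑_n ‖𝓮(n)‖ < ∞`.** -/
theorem summable_norm1_eFun (hirr : ∀ i, Irreducible (f i))
    (hna : Pairwise fun i j => ¬Associated (f i) (f j))
    (hρ : ∀ i p, p.Prime → polyRootCountMod ![f i] p < p) :
    Summable (fun n => SAlg.norm1 (eFun f n)) := by
  classical
  set h : ℕ → ℝ := fun n => SAlg.norm1 (eFun f n) with hh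
  have h0 : ∀ n, 0 ≤ h n := fun n => SAlg.norm1_nonneg _
  have h1 : h 1 = 1 := norm1_eFun_one f
  have h00 : h 0 ≤ 1 := by simp only [hh, ArithmeticFunction.map_zero, SAlg.norm1_zero]; norm_num
  have hsub : ∀ m n, 1 < m → 1 < n → Nat.Coprime m n → h (m * n) ≤ h m * h n := by
    intro m n _ _ hmn
    simp only [hh]
    rw [(isMultiplicative_eFun f).map_mul_of_coprime hmn]
    exact SAlg.norm1_mul_le _ _
  have hloc : ∀ p, p.Prime → Summable (fun v => h (p ^ v)) := fun p hp =>
    summable_norm1_eFun_prime_pow f hρ hp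
  -- a common bound `ρ_{f_i}(p) ≤ B`
  have hBi : ∀ i, ∃ B : ℝ, 1 ≤ B ∧ ∀ p : ℕ, p.Prime → (polyRootCountMod ![f i] p : ℝ) ≤ B :=
    fun i => exists_rootCount_prime_le (hirr i).ne_zero
  choose Bi hBi1 hBi using hBi
  set B : ℝ := 1 + ∑ i, Bi i with hBdef
  have hB0 : 0 ≤ B := by
    have : 0 ≤ ∑ i, Bi i := Finset.sum_nonneg fun i _ => by linarith [hBi1 i]
    linarith
  have hB : ∀ i p, p.Prime → (polyRootCountMod ![f i] p : ℝ) ≤ B := by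
    intro i p hp
    refine (hBi i p hp).trans ?_
    have : Bi i ≤ ∑ j, Bi j := Finset.single_le_sum (fun j _ => by linarith [hBi1 j]) (Finset.mem_univ i)
    linarith
  -- the good primes
  obtain ⟨P₀, hP₀⟩ := exists_forall_not_dvd_eval_and_dvd_eval hirr hna
  set P₁ : ℕ := max P₀ ⌈2 * B⌉₊ with hP₁
  have hgoodp : ∀ p : ℕ, p.Prime → P₁ < p → ∀ i i' : Fin k, i ≠ i' → ∀ n : ℕ,
      ¬(((p : ℕ) : ℤ) ∣ (f i).eval (n : ℤ) ∧ ((p : ℕ) : ℤ) ∣ (f i').eval (n : ℤ)) :=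
    fun p _ hp i i' hii' n => hP₀ p (lt_of_le_of_lt (le_max_left _ _) hp) i i' hii' (n : ℤ)
  -- the local tails `w_p = ∑_{v ≥ 1} h(p^v)`
  set w : ℕ → ℝ := fun p => ∑' v : ℕ, h (p ^ (v + 1)) with hw
  have hw0 : ∀ p, 0 ≤ w p := fun p => tsum_nonneg fun v => h0 _
  have hlocal : ∀ p : ℕ, p.Prime → ∑' v, h (p ^ v) = 1 + w p := by
    intro p hp
    rw [(hloc p hp).tsum_eq_zero_add, pow_zero, h1]
  set Mk : ℝ := ∑' u : ℕ, ((u : ℝ) + 3) ^ (2 * k + 1) * (1 / 2 : ℝ) ^ u with hMk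
  have hMk0 : 0 ≤ Mk := tsum_nonneg fun u => by positivity
  set c : ℝ := ((k : ℝ) + 1) * Mk * B ^ 2 with hc
  have hc0 : 0 ≤ c := by positivity
  have htail : ∀ p : ℕ, p.Prime → P₁ < p → w p ≤ c * ((1 + Real.log p) ^ (k + 1) / (p : ℝ) ^ 2) := by
    intro p hp hpP
    have hpB : 2 * B ≤ p := by
      have h2 : (⌈2 * B⌉₊ : ℝ) ≤ p := by exact_mod_cast ((le_max_right _ _).trans hpP.le)
      exact (Nat.le_ceil _).trans h2
    have := tsum_norm1_eFun_prime_pow_le_of_good f hρ hB0 hB hp (hgoodp p hp hpP) hpB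
    rw [hlocal p hp] at this
    have e : ((k : ℝ) + 1) * Mk * (B ^ 2 / (p : ℝ) ^ 2) * (1 + Real.log p) ^ (k + 1) =
        c * ((1 + Real.log p) ^ (k + 1) / (p : ℝ) ^ 2) := by rw [hc]; ring
    linarith
  -- the summable majorant over primes
  have hsumm : Summable (fun p : Nat.Primes => c * ((1 + Real.log p) ^ (k + 1) / ((p : ℕ) : ℝ) ^ 2)) :=
    (summable_primes_one_add_log_pow_div_sq (k + 1)).mul_left c
  set T : ℝ := ∑' p : Nat.Primes, c * ((1 + Real.log p) ^ (k + 1) / ((p : ℕ) : ℝ) ^ 2) with hT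
  set W : ℝ := ∑ p ∈ Nat.primesLE P₁, w p + T with hW
  -- `∑_{p ≤ X} w_p ≤ W`
  have hWX : ∀ X : ℕ, ∑ p ∈ Nat.primesLE X, w p ≤ W := by
    intro X
    rw [← Finset.sum_filter_add_sum_filter_not (Nat.primesLE X) (fun p => p ≤ P₁)]
    refine add_le_add ?_ ?_
    · refine Finset.sum_le_sum_of_subset_of_nonneg (fun p hp => ?_) fun p _ _ => hw0 p
      rw [Finset.mem_filter, Nat.mem_primesLE] at hp
      exact Nat.mem_primesLE.mpr ⟨hp.2, hp.1.2⟩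
    · calc ∑ p ∈ (Nat.primesLE X).filter (fun p => ¬p ≤ P₁), w p
          ≤ ∑ p ∈ (Nat.primesLE X).filter (fun p => ¬p ≤ P₁),
              c * ((1 + Real.log p) ^ (k + 1) / (p : ℝ) ^ 2) := by
            refine Finset.sum_le_sum fun p hp => ?_
            rw [Finset.mem_filter, Nat.mem_primesLE, not_le] at hp
            exact htail p hp.1.2 hp.2
        _ ≤ ∑ p ∈ Nat.primesLE X, c * ((1 + Real.log p) ^ (k + 1) / (p : ℝ) ^ 2) :=
            Finset.sum_le_sum_of_subset_of_nonneg (Finset.filter_subset _ _) fun p hp _ => by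
              have : 0 ≤ Real.log (p : ℝ) :=
                Real.log_nonneg (by exact_mod_cast (Nat.prime_of_mem_primesLE hp).one_lt.le)
              positivity
        _ ≤ T := sum_primesLE_le_tsum_primes (g := fun p => c * ((1 + Real.log p) ^ (k + 1) / (p : ℝ) ^ 2))
            (fun p => by
              rcases Nat.eq_zero_or_pos p with rfl | hp0
              · simp
              · have : (1 : ℝ) ≤ p ∨ True := Or.inr trivial
                by_cases hp1 : (1 : ℝ) ≤ p
                · have : 0 ≤ Real.log (p : ℝ) := Real.log_nonneg hp1; positivity
                · have : Real.log (p : ℝ) = 0 := by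
                    have : p = 0 ∨ p = 1 := by
                      rcases Nat.lt_or_ge p 2 with h2 | h2
                      · omega
                      · exfalso; exact hp1 (by exact_mod_cast (by omega : 1 ≤ p))
                    rcases this with rfl | rfl <;> simp
                  rw [this]; positivity) hsumm X
  -- bounded partial sums
  have hpartial : ∀ X : ℕ, ∑ n ∈ Icc 1 X, h n ≤ Real.exp W := by
    intro X
    refine (sum_le_prod_tsum_of_submultiplicative h h0 h1 h00 hsub hloc X).trans ?_
    calc ∏ p ∈ Nat.primesLE X, ∑' v, h (p ^ v) = ∏ p ∈ Nat.primesLE X, (1 + w p) :=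
          Finset.prod_congr rfl fun p hp => hlocal p (Nat.prime_of_mem_primesLE hp)
      _ ≤ ∏ p ∈ Nat.primesLE X, Real.exp (w p) :=
          Finset.prod_le_prod (fun p _ => by linarith [hw0 p]) fun p _ => by
            linarith [Real.add_one_le_exp (w p)]
      _ = Real.exp (∑ p ∈ Nat.primesLE X, w p) := by rw [Real.exp_sum]
      _ ≤ Real.exp W := Real.exp_le_exp.mpr (hWX X)
  -- conclude
  have hrange : ∀ N : ℕ, ∑ n ∈ Finset.range N, h n ≤ 1 + Real.exp W := by
    intro N
    have hsub' : Finset.range N ⊆ insert 0 (Icc 1 N) := by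
      intro n hn
      rw [Finset.mem_insert, Finset.mem_Icc]; rw [Finset.mem_range] at hn; omega
    calc ∑ n ∈ Finset.range N, h n ≤ ∑ n ∈ insert 0 (Icc 1 N), h n :=
          Finset.sum_le_sum_of_subset_of_nonneg hsub' fun n _ _ => h0 n
      _ = h 0 + ∑ n ∈ Icc 1 N, h n := Finset.sum_insert (by simp)
      _ ≤ 1 + Real.exp W := add_le_add h00 (hpartial N)
  exact summable_of_sum_range_le h0 hrange

end Summit.Parity.BatemanHorn.Theorems.TypeIMainTerm

end

/-!
# Type-I main term for Bateman–Horn (stmt-Parity-0873), input B4 (part 2):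
# the limit of the log-weighted singular series

* `compE f J`, `compF f J` — the components `E_J(n) = [ε_{univ ∖ J}] 𝓮(n)` and the real
  Dirichlet products `F_J = ∏_i (μ g_i log  if i ∈ J, else μ g_i)`;
* `coeff_univ_aFun_eq_sum` — **the exact identity** `a(m) = ∑_J (E_J ⋆ F_J)(m)` for the
  coefficients `a(m) = ∑_{d_1⋯d_k = m} G(d) ∏ μ(d_i) log d_i` of the singular series;
* `tendsto_sum_coeff_univ_aFun` — **`∑_{m ≤ N} a(m) → (∑_n 𝓮₀(n)) · ∏_i (−C(f_i))`**, where
  `𝓮₀(n) = [ε_∅] 𝓮(n)`: each `E_J` is absolutely summable (`summable_norm1_eFun`), each `F_J` has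
  partial sums `∏_i α_i + O(1/(1 + log N))` with `α_i = −C(f_i)` (`i ∈ J`) or `0`
  (`hasLogRate_prod`, `mg_mgl_rate`, `mg_mgl_variation`), so `tendsto_sum_mul_of_summable` applies
  and only `J = univ` survives.

Everything here is proved.
-/

noncomputable section

open Finset Polynomial ArithmeticFunction Filter Topology
open scoped ArithmeticFunction.Moebius

namespace Summit.Parity.BatemanHorn.Theorems.TypeIMainTerm

open Literature.NumberTheory.Sieve Literature.NumberTheory.LFunctions

variable {k : ℕ} (f : Fin k → ℤ[X])

/-- **The exact identity** `[ε_1⋯ε_k] 𝒶(m) = ∑_J (E_J ⋆ F_J)(m)`. -/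
theorem coeff_univ_aFun_eq_sum (m : ℕ) :
    SAlg.coeff (aFun f m) Finset.univ = ∑ J : Finset (Fin k), (compE f J * compF f J) m := by
  classical
  rw [aFun_eq_eFun_mul_prod_fFun, ArithmeticFunction.mul_apply, SAlg.coeff_finset_sum]
  simp_rw [ArithmeticFunction.mul_apply]
  rw [Finset.sum_comm]
  refine Finset.sum_congr rfl fun x _ => ?_
  -- expand `(∏ 𝒻_i)(x.2)` over tuples and extract the top coefficient
  rw [ArithmeticFunction.prod_apply_eq_sum_finMulAntidiag, Finset.mul_sum, SAlg.coeff_finset_sum]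
  simp_rw [compE_apply, compF, ArithmeticFunction.prod_apply_eq_sum_finMulAntidiag, Finset.mul_sum]
  rw [Finset.sum_comm]
  refine Finset.sum_congr rfl fun d _ => ?_
  simp_rw [fFun_eq_lin]
  rw [SAlg.coeff_univ_mul_prod_lin]
  refine Finset.sum_congr rfl fun J _ => ?_
  rw [mul_comm]
  congr 1
  rw [show (∏ i, (if i ∈ J then mgl f i else mg f i) (d i)) =
      ∏ i, (if i ∈ J then mgl f i (d i) else mg f i (d i)) from
      Finset.prod_congr rfl fun i _ => by split_ifs <;> rfl,
    Finset.prod_ite, Finset.filter_mem_eq_inter, Finset.univ_inter]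
  congr 1
  refine Finset.prod_congr (by ext i; simp) fun i _ => ?_
  simp only [mg_apply]

/-- `|E_J(n)| ≤ ‖𝓮(n)‖`, so `E_J` is absolutely summable. -/
theorem summable_abs_compE (hirr : ∀ i, Irreducible (f i))
    (hna : Pairwise fun i j => ¬Associated (f i) (f j))
    (hρ : ∀ i p, p.Prime → polyRootCountMod ![f i] p < p) (J : Finset (Fin k)) :
    Summable (fun n => |compE f J n|) :=
  Summable.of_nonneg_of_le (fun _ => abs_nonneg _) (fun _ => SAlg.abs_coeff_le_norm1 _ _)
    (summable_norm1_eFun f hirr hna hρ)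

/-- **The limit of the log-weighted singular series.**
`∑_{m ≤ N} [ε_1⋯ε_k] 𝒶(m) → (∑_n [ε_∅] 𝓮(n)) · ∏_i (−C(f_i))`. -/
theorem tendsto_sum_coeff_univ_aFun (hirr : ∀ i, Irreducible (f i))
    (hna : Pairwise fun i j => ¬Associated (f i) (f j))
    (hdeg : ∀ i, 1 ≤ (f i).natDegree) (hlc : ∀ i, 0 < (f i).leadingCoeff)
    (hρ : ∀ i p, p.Prime → polyRootCountMod ![f i] p < p) :
    Tendsto (fun N : ℕ => ∑ m ∈ Ioc 0 N, SAlg.coeff (aFun f m) Finset.univ) atTop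
      (𝓝 ((∑' n, SAlg.coeff (eFun f n) ∅) * ∏ i, (-batemanHornConst ![f i]))) := by
  classical
  set A : ℕ := k * (k + 2) + 1 with hA
  obtain ⟨K, hK0, hK⟩ := mg_mgl_rate f hirr hdeg hlc hρ A
  obtain ⟨M, hM1, hM⟩ := mg_mgl_variation f hirr hdeg
  -- the individual limits
  set α : Finset (Fin k) → Fin k → ℝ := fun J i => if i ∈ J then -batemanHornConst ![f i] else 0
  have hlim : ∀ J : Finset (Fin k), Tendsto (fun N : ℕ => ∑ m ∈ Ioc 0 N, (compE f J * compF f J) m)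
      atTop (𝓝 ((∑' n, compE f J n) * ∏ i, α J i)) := by
    intro J
    set G : Fin k → ArithmeticFunction ℝ := fun i => if i ∈ J then mgl f i else mg f i with hG
    have hF : ∀ i, ∀ N : ℕ, 1 ≤ N → |∑ n ∈ Ioc 0 N, G i n - α J i| ≤ K / (1 + Real.log N) ^ A := by
      intro i N hN
      by_cases hi : i ∈ J
      · simp only [hG, α, if_pos hi]; exact (hK i).2 N hN
      · simp only [hG, α, if_neg hi]; exact (hK i).1 N hN
    have hV : ∀ i, ∀ N : ℕ, 1 ≤ N → ∑ n ∈ Ioc 0 N, |G i n| ≤ M * (1 + Real.log N) ^ 2 := by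
      intro i N hN
      by_cases hi : i ∈ J
      · simp only [hG, if_pos hi]; exact (hM i).2 N hN
      · simp only [hG, if_neg hi]; exact (hM i).1 N hN
    obtain ⟨K', hK'0, hrate, -⟩ := hasLogRate_prod k G (α J) A K M hK0 hM1 (by rw [hA]; omega) hF hV
    have hA1 : A - k * (k + 2) = 1 := by rw [hA]; omega
    rw [hA1] at hrate
    simp only [pow_one] at hrate
    have hprod : compF f J = ∏ i, G i := rfl
    rw [hprod]
    exact tendsto_sum_mul_of_summable (compE f J) (∏ i, G i) hK'0 (summable_abs_compE f hirr hna hρ J) hrate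
  -- sum over `J`; only `J = univ` survives
  have hsum := tendsto_finsetSum (Finset.univ : Finset (Finset (Fin k))) fun J _ => hlim J
  have hval : ∑ J : Finset (Fin k), (∑' n, compE f J n) * ∏ i, α J i =
      (∑' n, SAlg.coeff (eFun f n) ∅) * ∏ i, (-batemanHornConst ![f i]) := by
    rw [Finset.sum_eq_single Finset.univ]
    · simp only [α, Finset.mem_univ, if_true, compE_apply, Finset.sdiff_self]
    · intro J _ hJ
      obtain ⟨i, hi⟩ : ∃ i, i ∉ J := by
        by_contra h; push Not at h
        exact hJ (Finset.eq_univ_iff_forall.mpr h)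
      rw [Finset.prod_eq_zero (Finset.mem_univ i) (by simp only [α, if_neg hi]), mul_zero]
    · intro h; exact absurd (Finset.mem_univ _) h
  rw [← hval]
  refine hsum.congr fun N => ?_
  rw [Finset.sum_comm]
  exact Finset.sum_congr rfl fun m _ => (coeff_univ_aFun_eq_sum f m).symm

end Summit.Parity.BatemanHorn.Theorems.TypeIMainTerm

end
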